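import Literature.AnabelianGeometry.EtaleTheta.ArithThetaTowerPrelim
import Literature.IUT.HodgeTheaters.BadLocalFrobenioidBases
import Literature.IUT.HodgeTheaters.GaloisCosetFields
import HarnessLib

/-!
# [EtTh] Def. 3.3 (iii) for the ARITHMETIC theta tower (GAP A, item GA-02), ENGINE: the Def. 3.3 (iii) data over the kit's own
# base `𝒟_v̲ = CosetCat Π` with GENUINE CONSTANTS `(Ω^{aug U})^×` at every `U`, for any geometric log-divisor model with `Π`-action

S. Mochizuki, *The étale theta function …*, Publ. RIMS **45** (2009) [MochizukiEtTh2009], §3, Def. 3.3 (iii) PRIMS PDF p.73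
(«`Φ₀(Y^log) := lim Div⁺(Z^log_∞)^{Gal(Z^log_∞/Y^log)}`; `B₀(Y^log) := lim Mero(Z^log_∞)^{Gal(Z^log_∞/Y^log)}` … a natural transformation
`B₀ → Φ₀^gp` … `F₀ ⊆ B₀` the subfunctor determined by the constant log-meromorphic functions»), Prop. 3.4 (ii) p.74 («`L^× ≅ F₀(Y^log)`»)
[cite: MochizukiEtTh2009, Def 3.3 p.73]; S. Mochizuki, *Inter-universal Teichmüller Theory I*, Ex. 3.2 (i) p.70 («`𝒟_v := B^temp(X̲̲_v)⁰` …
`𝒟⊢_v := B(K_v)⁰` … a natural functor `𝒟_v → 𝒟⊢_v`») [claim: Mochizuki2012, status: disputed — nothing of the series is asserted here];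
[FrdII] = [MochizukiFrdII2008] Ex. 1.1 (i) p.7.

abc-iut cell, GAP A = G-L5-EX32I-1 (the UNDISPUTED construction around [IUTchIII] Cor. 3.12), item **GA-02** (GAP-SIZING-A.md
69de97346848d3e8 §2 row D2; chair's RULED SHAPE `plan/L5/GAP-A-SIGNATURES.md` v1 e3ccddf9b87597cf §0/§2: binders
`{p} [Fact p.Prime] (d : GaloisValDatum.{0} p) {P : Type} [Group P] [TopologicalSpace P] (T : BadLocalGroupDatum d.Gal P)`, result
`DivisorMonoids.{0,0,0} T.Dv`; RULINGS #317 (2) / #319 (c1)–(c4) / #321 / #322 (c2′)(c3′) / #330–#333), seat abc-iut-gapA-02-divisorMonoids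
(abc-iut-L2-t1 class).  CLASS (b) CONSTRUCTION, consumed BY NAME: the frozen `DivisorMonoids` (`DivisorMonoids.lean`), abc-iut-w6-d058's
`DivisorMonoids.ofGaloisAction A hZ` (`DivisorMonoidsOfGaloisCovering.lean`) and its laws, abc-iut-w5-d179's `DivisorMonoids.precomp`,
abc-iut-L5-t2's kit vocabulary `BadLocalGroupDatum` / `T.Dv = CosetCat P` / `T.proj = CosetCat.push T.aug _` (`BadLocalFrobenioidBases.lean`)
and `GaloisValDatum.fieldFunctor : CosetCat d.Gal ⥤ PadicFld p`, `U′ ↦ Ω^{U′}` (`GaloisCosetFields.lean`), abc-iut-L1's [FrdII] Ex. 1.1 (i)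
data (`PadicFrd.bZero`, `OrdInt`, `divUnits`), and THIS seat's `DivisorMonoids.prod` / `ofPadicBase` / `ArithThetaTower.cosetGSetFunctor`
(`ArithThetaTowerPrelim.lean`).

WHAT IS CONSTRUCTED (the chair's line of #321/#322 «`Φ₀(U) := Φ₀^geom(rebase U) + ord(Ω^{aug U})·F`, `B₀(U) := (Ω^{aug U})^× · B₀^geom(rebase U)`,
`F₀(U) := (Ω^{aug U})^×` (image of the constant tower via `T.proj`)», with `+` / `·` READ AS DIRECT PRODUCT — the typer's call of §6 there):
* `NΘ T`, `ΓΘ T := P ⧸ NΘ T`, `rebase T : T.Dv ⥤ CosetCat (ΓΘ T)` — the theta envelope and the rebase functor `P/U ↦ ΓΘ/(U·NΘ/NΘ)` of D0′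
  (#321/#322), BY NAME (used by the decreed envelope of the sequel file, whose `P`-action factors through `ΓΘ T`).
* `constDivisorMonoids d T := DivisorMonoids.ofPadicBase (T.proj ⋙ d.fieldFunctor)` — the GENUINE CONSTANTS at EVERY `U ∈ 𝒟_v̲`:
  `B₀ = F₀ = (Ω^{aug U})^×`, `Φ₀ = ord(𝒪^▷_{Ω^{aug U}})` («`ord(Ω^{aug U})·F`», the constants' multiples of the special fibre measured in the
  genuine value monoid, so that the ramification indices `e(U′|U)` are carried by the field inclusions `fixedHom` themselves), `div₀ =` the
  valuation (`divUnits`).  Constants go through `T.proj`, NOT through `rebase` (#321 design finding: sub-gap (a) needs them at the deep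
  objects of `𝒟⊢ ⊆ 𝒟`).  (`= T.proj.op ⋙ GA-01's constTower d` once that lands — TODO-merge: abc-iut-gapA-01-ConstTower; this file uses
  the tree decls `fieldFunctor` / `PadicFrd.bZero` directly, so the merge is `rfl` or an isomorphism.)
* `geomDivisorMonoids A hZ := (DivisorMonoids.ofGaloisAction A hZ).precomp (cosetGSetFunctor P)` — the geometric Def. 3.3 (iii) data
  `Φ₀^geom(U) = Hom_P(P/U, Div⁺(Z)) = Div⁺(Z)^U`, `B₀^geom(U) = Mero(Z)^U` of ANY log-divisor model `Z` with `P`-action `A`, read over the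
  small base `CosetCat P`.
* **`divisorMonoidsOf d T A hZ := (constDivisorMonoids d T).prod (geomDivisorMonoids A hZ) : DivisorMonoids.{0,0,0} T.Dv`** — THE ENGINE:
  `Φ₀(U) = ord(𝒪^▷_{Ω^{aug U}}) × Div⁺(Z)^U`, `B₀(U) = (Ω^{aug U})^× × Mero(Z)^U`, `div₀ = (valuation) × (log-divisor of zeroes and poles)`,
  `F₀(U) = (Ω^{aug U})^× × (constant functions of Z)^U`; ALL TWELVE `DivisorMonoids` FIELDS ARE DEFINITIONS OR THEOREMS (no law is left
  to the laws-half item); `rfl` lemmas for every field; the transitions of `B₀` and `Φ₀^geom` are INJECTIVE (`divisorMonoidsOf_B₀_map_injective`,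
  the Def. 3.6 (i) binder `hBinj` of the downstream items, from the injectivity of field homomorphisms and abc-iut-w6-d058's
  `bZeroPull_injective` along the surjections `P/U ↠ P/V`).
The chair's exact decl `ArithThetaTower.divisorMonoids d T` = this engine at the DECREED theta envelope of `T` is the sequel
`ArithThetaTowerEnvelope.lean` (#322 (c2′)/(c3′) label there).

No `Prop`-valued fact, no instance, no notation, no sorry.  HONEST FRAMING: a construction over typed interfaces — the constants ARE
the genuine `(Ω^{aug U})^×` of the kit's `GaloisValDatum`, the geometric factor is whatever `(Z, A)` is fed in; nothing here is asserted to be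
the tempered Frobenioid of a Tate curve; no side taken on [IUTchIII] Cor. 3.12 (the construction is the undisputed one around it); typed ≠
inhabited ≠ proved-in-print; NO abc claim.
-/

noncomputable section

namespace Literature.AnabelianGeometry.EtaleTheta

open CategoryTheory Opposite Function Literature.AlgebraicGeometry.Frobenioids
  Literature.AlgebraicGeometry.Frobenioids.PadicFrd Literature.AnabelianGeometry.SemiGraphs Literature.IUT.HodgeTheaters
  LogDivisorModel LogDivisorModel.GaloisAction

namespace ArithThetaTower

variable {p : ℕ} [Fact p.Prime] (d : GaloisValDatum.{0} p) {P : Type} [Group P] [TopologicalSpace P]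
  (T : BadLocalGroupDatum d.Gal P)

/-! ## §1 The theta envelope `NΘ ⊴ Π`, `ΓΘ = Π/NΘ` and the rebase functor (D0′, RULINGS #321/#322) -/

/-- **`N_Θ := core_Π(Π_Ÿ)`**, the normal core of the open subgroup `Π_Ÿ ⊆ Π` of the covering `Ÿ_v̲` — the open normal subgroup of the
«theta envelope», the Galois closure of `Ÿ_T → X̲̲_v̲` (D0′ of GAP-SIZING-A §8/§9; RULINGS #321/#322). [cite: MochizukiEtTh2009, Def 3.3 p.73] -/
abbrev NΘ : Subgroup P := (T.Y : Subgroup P).normalCore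

/-- `N_Θ ⊆ Π_Ÿ`. [cite: MochizukiEtTh2009, Def 3.3 p.73] -/
theorem NΘ_le_Y : NΘ d T ≤ (T.Y : Subgroup P) := Subgroup.normalCore_le _

/-- `N_Θ` is normal in `Π`. [cite: MochizukiEtTh2009, Def 3.3 p.73] -/
theorem NΘ_normal : (NΘ d T).Normal := Subgroup.normalCore_normal _

/-- **`Γ_Θ := Π ⧸ N_Θ`** — the Galois group of the theta envelope over `X̲̲_v̲` (FINITE whenever `Π_Ÿ` has finite index, e.g. `Π` profinite).
[cite: MochizukiEtTh2009, Def 3.3 p.73] -/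
abbrev ΓΘ : Type := P ⧸ NΘ d T

section Rebase

variable [SeparatelyContinuousMul P]

/-- **The rebase functor `𝒟_v̲ = CosetCat Π ⥤ CosetCat Γ_Θ`, `Π/U ↦ Γ_Θ/(U·N_Θ/N_Θ)`** («the maximal sub-covering of the envelope dominated
by `U`»; abc-iut-L5-t2's `CosetCat.push` along the open quotient map — a FUNCTOR by construction, no tower level is selected; #321/#322 (c3′)
«off-lattice Φ via `rebase`/pullback»).  The quotient map is open as soon as the translations of `Π` are continuous
(`SeparatelyContinuousMul`, carried by the slot's `↥(B x hx).H` as a subgroup of a topological group; used by THIS decl only).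
[cite: MochizukiFrdII2008, Ex 1.3 (ii) p.11] -/
def rebase : T.Dv ⥤ CosetCat (ΓΘ d T) := CosetCat.push (QuotientGroup.mk' (NΘ d T)) QuotientGroup.isOpenMap_coe

/-- `rebase` on objects: the image subgroup `U·N_Θ/N_Θ`. [cite: MochizukiFrdII2008, Ex 1.3 (ii) p.11] -/
theorem rebase_obj_sg (U : T.Dv) :
    ((rebase d T).obj U).sg = CosetCat.mapOpen (QuotientGroup.mk' (NΘ d T)) QuotientGroup.isOpenMap_coe U.sg := rfl

end Rebase

/-! ## §2 The constants factor: GENUINE `(Ω^{aug U})^×` at every `U ∈ 𝒟_v̲`, through `T.proj` -/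

/-- **The Def. 3.3 (iii) data of the GENUINE CONSTANTS over `𝒟_v̲ = CosetCat Π`**: at `U`, `B₀ = F₀ = (Ω^{aug U})^×` (the unit group of the
fixed field of `aug(U) ⊆ G_v̲` — the constant field of the covering `U`), `Φ₀ = ord(𝒪^▷_{Ω^{aug U}})` («`ord(Ω^{aug U})·F`»), `div₀ =` the valuation;
along `T.proj : 𝒟_v̲ → 𝒟⊢_v̲` and abc-iut-L5-t2's field functor `U′ ↦ Ω^{U′}` (NOT along `rebase`, #321). [cite: MochizukiEtTh2009, Def 3.3 p.73] -/
def constDivisorMonoids : DivisorMonoids.{0, 0, 0} T.Dv := DivisorMonoids.ofPadicBase (T.proj ⋙ d.fieldFunctor)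

/-- The constant field `Ω^{aug U}` of the covering `U`, as a valued field (object of [FrdII]'s `D₀`). [cite: Mochizuki2012, I Ex 3.3 (i) p.78] -/
abbrev constFld (U : T.Dv) : PadicFld.{0} p := d.fieldFunctor.obj (T.proj.obj U)

/-- The constant field of `U` IS the fixed field `Ω^{aug(U)}` (definitionally). [cite: Mochizuki2012, I Ex 3.3 (i) p.78] -/
theorem constFld_K (U : T.Dv) :
    (constFld d T U).K = d.fixedFld ⟨CosetCat.mapOpen T.aug T.isOpenMap_aug U.sg⟩ := rfl

/-- `B₀` of the constants factor at `U` is `(Ω^{aug U})^×`. [cite: MochizukiEtTh2009, Def 3.3 p.73] -/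
theorem constDivisorMonoids_B₀_obj (U : T.Dvᵒᵖ) :
    (constDivisorMonoids d T).B₀.obj U = CommMonCat.of ((constFld d T U.unop).K)ˣ := rfl

/-- `Φ₀` of the constants factor at `U` is `ord(𝒪^▷_{Ω^{aug U}})`. [cite: MochizukiEtTh2009, Def 3.3 p.73] -/
theorem constDivisorMonoids_Φ₀_obj (U : T.Dvᵒᵖ) :
    (constDivisorMonoids d T).Φ₀.obj U = CommMonCat.of (OrdInt (constFld d T U.unop).K) := rfl

/-- `div₀` of the constants factor is the valuation `(Ω^{aug U})^× → ord((Ω^{aug U})^×)`. [cite: MochizukiEtTh2009, Def 3.3 p.73] -/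
theorem constDivisorMonoids_div₀ (U : T.Dvᵒᵖ) : (constDivisorMonoids d T).div₀ U = divUnits (constFld d T U.unop).K := rfl

/-- `F₀ = B₀` for the constants factor (every constant is a constant function). [cite: MochizukiEtTh2009, Prop 3.4 p.74] -/
theorem constDivisorMonoids_F₀ (U : T.Dvᵒᵖ) : (constDivisorMonoids d T).F₀ U = ⊤ := rfl

/-- The transition map of the constants' `B₀` along `f : U → V` is `Units.map` of the field homomorphism `Ω^{aug V} → Ω^{aug U}` (abc-iut-L5-t2's
`fixedHom` of `T.proj.map f`). [cite: MochizukiEtTh2009, Def 3.3 p.73] -/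
theorem constDivisorMonoids_B₀_map_hom {U V : T.Dvᵒᵖ} (f : U ⟶ V) :
    ((constDivisorMonoids d T).B₀.map f).hom =
      Units.map ((d.fieldFunctor.map (T.proj.map f.unop)).alg : (constFld d T U.unop).K →* (constFld d T V.unop).K) := rfl

/-- **The transition maps of the constants' `B₀` are injective** (field homomorphisms are injective). [cite: MochizukiEtTh2009, Def 3.3 p.73] -/
theorem constDivisorMonoids_B₀_map_injective {U V : T.Dvᵒᵖ} (f : U ⟶ V) :
    Injective ((constDivisorMonoids d T).B₀.map f).hom := by
  rw [constDivisorMonoids_B₀_map_hom]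
  exact Units.map_injective (d.fieldFunctor.map (T.proj.map f.unop)).alg.injective

/-! ## §3 The geometric factor: `Div⁺(Z)^U`, `Mero(Z)^U` of a log-divisor model with `Π`-action, over `CosetCat Π` -/

section Geom

variable {Z : LogDivisorModel.{0}} (A : Z.GaloisAction P) (hZ : Z.CuspLaws)

/-- **The geometric Def. 3.3 (iii) data over `CosetCat Π`**: abc-iut-w6-d058's `ofGaloisAction A hZ` (`Φ₀(S) = Hom_Π(S, Div⁺(Z))`,
`B₀(S) = Hom_Π(S, Mero(Z))`, `div₀` = log-divisor of zeroes and poles, `F₀` = the constant functions of `Z`) read at the `Π`-sets `Π/U`.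
[cite: MochizukiEtTh2009, Def 3.3 p.73] -/
def geomDivisorMonoids : DivisorMonoids.{0, 0, 0} (CosetCat P) :=
  (DivisorMonoids.ofGaloisAction A hZ).precomp (cosetGSetFunctor P)

/-- `Φ₀^geom(U) = Hom_Π(Π/U, Div⁺(Z))`. [cite: MochizukiEtTh2009, Def 3.3 p.73] -/
theorem geomDivisorMonoids_Φ₀_obj (U : (CosetCat P)ᵒᵖ) :
    (geomDivisorMonoids A hZ).Φ₀.obj U = CommMonCat.of (A.phiZero ((cosetGSetFunctor P).obj U.unop)) := rfl

/-- `B₀^geom(U) = Hom_Π(Π/U, Mero(Z))`. [cite: MochizukiEtTh2009, Def 3.3 p.73] -/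
theorem geomDivisorMonoids_B₀_obj (U : (CosetCat P)ᵒᵖ) :
    (geomDivisorMonoids A hZ).B₀.obj U = CommMonCat.of (A.bZero ((cosetGSetFunctor P).obj U.unop)) := rfl

/-- `div₀^geom` is abc-iut-w6-d058's `divZeroHom` at `Π/U`. [cite: MochizukiEtTh2009, Def 3.3 p.73] -/
theorem geomDivisorMonoids_div₀ (U : (CosetCat P)ᵒᵖ) :
    (geomDivisorMonoids A hZ).div₀ U = A.divZeroHom ((cosetGSetFunctor P).obj U.unop) := rfl

/-- `F₀^geom(U)` = the `U`-invariant constant functions of `Z`. [cite: MochizukiEtTh2009, Def 3.3 p.73] -/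
theorem geomDivisorMonoids_F₀ (U : (CosetCat P)ᵒᵖ) :
    (geomDivisorMonoids A hZ).F₀ U = A.fZero ((cosetGSetFunctor P).obj U.unop) := rfl

/-- `Φ₀^geom` on morphisms is pull-back along `Π/U → Π/V`. [cite: MochizukiEtTh2009, Def 3.3 p.73] -/
theorem geomDivisorMonoids_Φ₀_map_hom {U V : (CosetCat P)ᵒᵖ} (f : U ⟶ V) :
    ((geomDivisorMonoids A hZ).Φ₀.map f).hom = A.phiZeroPull ((cosetGSetFunctor P).map f.unop) := rfl

/-- `B₀^geom` on morphisms is pull-back along `Π/U → Π/V`. [cite: MochizukiEtTh2009, Def 3.3 p.73] -/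
theorem geomDivisorMonoids_B₀_map_hom {U V : (CosetCat P)ᵒᵖ} (f : U ⟶ V) :
    ((geomDivisorMonoids A hZ).B₀.map f).hom = A.bZeroPull ((cosetGSetFunctor P).map f.unop) := rfl

/-- **The transitions of `B₀^geom` are injective** (`Mero(Z)^V ↪ Mero(Z)^U` along the surjection `Π/U ↠ Π/V`).
[cite: MochizukiEtTh2009, Def 3.3 p.73] -/
theorem geomDivisorMonoids_B₀_map_injective {U V : (CosetCat P)ᵒᵖ} (f : U ⟶ V) :
    Injective ((geomDivisorMonoids A hZ).B₀.map f).hom :=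
  A.bZeroPull_injective _ (cosetGSetFunctor_map_surjective P f.unop)

/-- **The transitions of `Φ₀^geom` are injective.** [cite: MochizukiEtTh2009, Def 3.3 p.73] -/
theorem geomDivisorMonoids_Φ₀_map_injective {U V : (CosetCat P)ᵒᵖ} (f : U ⟶ V) :
    Injective ((geomDivisorMonoids A hZ).Φ₀.map f).hom :=
  A.phiZeroPull_injective _ (cosetGSetFunctor_map_surjective P f.unop)

end Geom

/-! ## §4 THE ENGINE: genuine constants × geometric data over `𝒟_v̲ = CosetCat Π` -/

section Engine

variable {Z : LogDivisorModel.{0}} (A : Z.GaloisAction P) (hZ : Z.CuspLaws)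

/-- **The [EtTh] Def. 3.3 (iii) data of the arithmetic theta tower over the kit's own base `𝒟_v̲ = CosetCat Π`, ENGINE FORM** — for the
constant datum `d` (`K_v̲`, `Ω = K̄_v̲`), the kit's `T` (`aug : Π → G_v̲`, `Π_Ÿ`) and ANY geometric log-divisor model `Z` with `Π`-action `A`:
`Φ₀(U) = ord(𝒪^▷_{Ω^{aug U}}) × Div⁺(Z)^U` («`Φ₀^geom + ord(Ω^{aug U})·F`»), `B₀(U) = (Ω^{aug U})^× × Mero(Z)^U` («`(Ω^{aug U})^× · B₀^geom`»),
`div₀ = ` valuation × log-divisor of zeroes and poles, `F₀(U) = (Ω^{aug U})^× × (constants of Z)^U`.  Every field a definition or a theorem.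
[cite: MochizukiEtTh2009, Def 3.3 p.73] -/
def divisorMonoidsOf : DivisorMonoids.{0, 0, 0} T.Dv := (constDivisorMonoids d T).prod (geomDivisorMonoids A hZ)

/-- The engine IS «constants × geometric» (by definition). [cite: MochizukiEtTh2009, Def 3.3 p.73] -/
theorem divisorMonoidsOf_eq : divisorMonoidsOf d T A hZ = (constDivisorMonoids d T).prod (geomDivisorMonoids A hZ) := rfl

/-- **`Φ₀(U) = ord(𝒪^▷_{Ω^{aug U}}) × Hom_Π(Π/U, Div⁺(Z))`** (definitionally; the shape GA-03's `hpf` is stated against).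
[cite: MochizukiEtTh2009, Def 3.3 p.73] -/
theorem divisorMonoidsOf_Φ₀_obj (U : T.Dvᵒᵖ) :
    (divisorMonoidsOf d T A hZ).Φ₀.obj U =
      CommMonCat.of (OrdInt (constFld d T U.unop).K × A.phiZero ((cosetGSetFunctor P).obj U.unop)) := rfl

/-- **`B₀(U) = (Ω^{aug U})^× × Hom_Π(Π/U, Mero(Z))`** (definitionally). [cite: MochizukiEtTh2009, Def 3.3 p.73] -/
theorem divisorMonoidsOf_B₀_obj (U : T.Dvᵒᵖ) :
    (divisorMonoidsOf d T A hZ).B₀.obj U =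
      CommMonCat.of (((constFld d T U.unop).K)ˣ × A.bZero ((cosetGSetFunctor P).obj U.unop)) := rfl

/-- `Φ₀` on morphisms: `ord`-restriction × pull-back. [cite: MochizukiEtTh2009, Def 3.3 p.73] -/
theorem divisorMonoidsOf_Φ₀_map_apply {U V : T.Dvᵒᵖ} (f : U ⟶ V)
    (x : OrdInt (constFld d T U.unop).K × A.phiZero ((cosetGSetFunctor P).obj U.unop)) :
    ((divisorMonoidsOf d T A hZ).Φ₀.map f).hom x =
      (ordIntMapOfHom (d.fieldFunctor.map (T.proj.map f.unop)).alg (d.fieldFunctor.map (T.proj.map f.unop)).isValHom x.1,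
        A.phiZeroPull ((cosetGSetFunctor P).map f.unop) x.2) := rfl

/-- `B₀` on morphisms: field inclusion on units × pull-back. [cite: MochizukiEtTh2009, Def 3.3 p.73] -/
theorem divisorMonoidsOf_B₀_map_apply {U V : T.Dvᵒᵖ} (f : U ⟶ V)
    (b : ((constFld d T U.unop).K)ˣ × A.bZero ((cosetGSetFunctor P).obj U.unop)) :
    ((divisorMonoidsOf d T A hZ).B₀.map f).hom b =
      (Units.map ((d.fieldFunctor.map (T.proj.map f.unop)).alg : (constFld d T U.unop).K →* (constFld d T V.unop).K) b.1,
        A.bZeroPull ((cosetGSetFunctor P).map f.unop) b.2) := rfl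

/-- **`div₀ (c, b) = ι₁(ord c) · ι₂(div₀^geom b)`** in `(ord(𝒪^▷) × Div⁺(Z)^U)^gp`. [cite: MochizukiEtTh2009, Def 3.3 p.73] -/
theorem divisorMonoidsOf_div₀_apply (U : T.Dvᵒᵖ) (b : ((constFld d T U.unop).K)ˣ × A.bZero ((cosetGSetFunctor P).obj U.unop)) :
    (divisorMonoidsOf d T A hZ).div₀ U b =
      gpMap (MonoidHom.inl _ _) (divUnits (constFld d T U.unop).K b.1) *
        gpMap (MonoidHom.inr _ _) (A.divZeroHom ((cosetGSetFunctor P).obj U.unop) b.2) := rfl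

/-- **`F₀(U) = (Ω^{aug U})^× × (constant functions of Z)^U`** — the genuine constants sit in `F₀` at EVERY `U`.
[cite: MochizukiEtTh2009, Def 3.3 p.73] -/
theorem divisorMonoidsOf_F₀ (U : T.Dvᵒᵖ) :
    (divisorMonoidsOf d T A hZ).F₀ U = (⊤ : Submonoid ((constFld d T U.unop).K)ˣ).prod (A.fZero ((cosetGSetFunctor P).obj U.unop)) := rfl

/-- Every genuine constant `c ∈ (Ω^{aug U})^×` lies in `F₀(U)` (paired with the trivial function). [cite: MochizukiEtTh2009, Prop 3.4 p.74] -/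
theorem const_mem_F₀ (U : T.Dvᵒᵖ) (c : ((constFld d T U.unop).K)ˣ) :
    ((c, 1) : ((constFld d T U.unop).K)ˣ × A.bZero ((cosetGSetFunctor P).obj U.unop)) ∈ (divisorMonoidsOf d T A hZ).F₀ U :=
  ⟨trivial, Submonoid.one_mem _⟩

/-- `ncsp₀(U) = ⊤ × (non-cuspidal geometric divisors)`: the constants' divisors are special-fibre divisors. [cite: MochizukiEtTh2009, Def 3.3 p.73] -/
theorem divisorMonoidsOf_ncsp₀ (U : T.Dvᵒᵖ) :
    (divisorMonoidsOf d T A hZ).ncsp₀ U =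
      (⊤ : Submonoid (OrdInt (constFld d T U.unop).K)).prod (A.ncspZero ((cosetGSetFunctor P).obj U.unop)) := rfl

/-- `csp₀(U) = ⊥ × (cuspidal geometric divisors)`. [cite: MochizukiEtTh2009, Def 3.3 p.73] -/
theorem divisorMonoidsOf_csp₀ (U : T.Dvᵒᵖ) :
    (divisorMonoidsOf d T A hZ).csp₀ U =
      (⊥ : Submonoid (OrdInt (constFld d T U.unop).K)).prod (A.cspZero ((cosetGSetFunctor P).obj U.unop)) := rfl

/-- **The transition maps of `B₀` are INJECTIVE** — the Def. 3.6 (i) binder `hBinj` of the downstream realification / Frobenioid items HOLDS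
at the engine for every geometric input. [cite: MochizukiEtTh2009, Def 3.6 p.76] -/
theorem divisorMonoidsOf_B₀_map_injective {U V : T.Dvᵒᵖ} (f : U ⟶ V) :
    Injective ((divisorMonoidsOf d T A hZ).B₀.map f).hom := by
  rintro ⟨c, b⟩ ⟨c', b'⟩ h
  have h1 := congrArg Prod.fst h
  have h2 := congrArg Prod.snd h
  rw [divisorMonoidsOf_B₀_map_apply, divisorMonoidsOf_B₀_map_apply] at h1 h2
  exact Prod.ext (constDivisorMonoids_B₀_map_injective d T f h1) (geomDivisorMonoids_B₀_map_injective A hZ f h2)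

/-- The geometric component of every `Φ₀`-transition is injective. [cite: MochizukiEtTh2009, Def 3.3 p.73] -/
theorem divisorMonoidsOf_Φ₀_map_snd_injective {U V : T.Dvᵒᵖ} (f : U ⟶ V)
    (x y : OrdInt (constFld d T U.unop).K × A.phiZero ((cosetGSetFunctor P).obj U.unop))
    (h : ((divisorMonoidsOf d T A hZ).Φ₀.map f).hom x = ((divisorMonoidsOf d T A hZ).Φ₀.map f).hom y) : x.2 = y.2 := by
  have h2 := congrArg Prod.snd h
  rw [divisorMonoidsOf_Φ₀_map_apply, divisorMonoidsOf_Φ₀_map_apply] at h2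
  exact geomDivisorMonoids_Φ₀_map_injective A hZ f h2

/-- **Prop. 3.4 (ii), first clause, REDUCES TO THE GEOMETRIC FACTOR**: if every `U`-invariant log-meromorphic function of `Z` with trivial
divisor is constant, then every element of `B₀(U)` with trivial divisor lies in `F₀(U)` (the constants' factor satisfies it identically).
[cite: MochizukiEtTh2009, Prop 3.4 p.74] -/
theorem divisorMonoidsOf_ker_div₀_le_F₀ (U : T.Dvᵒᵖ)
    (hgeom : ∀ b : A.bZero ((cosetGSetFunctor P).obj U.unop), A.divZeroHom _ b = 1 → b ∈ A.fZero _)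
    (b : ((constFld d T U.unop).K)ˣ × A.bZero ((cosetGSetFunctor P).obj U.unop))
    (hb : gpMap (MonoidHom.inr (OrdInt (constFld d T U.unop).K) _) (A.divZeroHom ((cosetGSetFunctor P).obj U.unop) b.2) = 1) :
    b ∈ (divisorMonoidsOf d T A hZ).F₀ U := by
  refine ⟨trivial, hgeom b.2 ?_⟩
  -- `ι₂ = gpMap inr` is injective: `gpMap snd ∘ gpMap inr = id`
  have key : gpMap (MonoidHom.snd (OrdInt (constFld d T U.unop).K) _)
      (gpMap (MonoidHom.inr (OrdInt (constFld d T U.unop).K) _) (A.divZeroHom ((cosetGSetFunctor P).obj U.unop) b.2)) =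
        A.divZeroHom ((cosetGSetFunctor P).obj U.unop) b.2 := by
    rw [← gpMap_comp_apply'', MonoidHom.snd_comp_inr, gpMap_eq_monGpMap, MonGp.map_id]
    rfl
  rw [← key, hb, map_one]

end Engine

end ArithThetaTower

end Literature.AnabelianGeometry.EtaleTheta

end
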